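import Literature.Algebra.EuclideanLattices.LatticePointCounting
import Mathlib.Data.Int.Interval
import Mathlib.MeasureTheory.Measure.Haar.OfBasis
import HarnessLib

/-!
# Lattice points in anisotropically stretched regions (Davenport's lemma via the Lipschitz principle)

Topic `Literature/Algebra/EuclideanLattices` (geometry of numbers). Everything in this file is
PROVED; it continues `LatticePointCounting.lean` (Marcus's cell counting:
`|#(S ∩ ℤⁿ) − vol(S)| ≤ #{unit cubes meeting frontier S}`, `abs_card_mul_sub_measure_le`).

H. Davenport, *On a principle of Lipschitz*, J. London Math. Soc. 26 (1951) 179–183, proves that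
for a bounded region `R ⊂ ℝⁿ` cut out by boundedly many algebraic conditions the number of integer
points is `vol(R) + O(max{V̄, 1})`, `V̄` the largest volume of a projection of `R` on a coordinate
subspace; Bhargava–Shankar, Ann. of Math. 181 (2015), Props. 2.5–2.6, use it for the regions
`n a(t) λ · G₀L` of binary quartic forms, where the coordinates are stretched by the unequal
factors `λ⁴t⁻⁴, λ⁴t⁻², λ⁴, λ⁴t², λ⁴t⁴` and the error must be the product of the four LARGEST factors
(`O(t⁴λ¹⁶)`), not the fourth power of the largest. This file proves the anisotropic estimate in the
Lipschitz-principle form that suffices for such applications: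

* `card_unitCubes_meeting_image_le` (**anisotropic Lipschitz principle**): if
  `φ : [0,1]^m → ℝⁿ` is coordinatewise Lipschitz, `|φ(x)_i − φ(y)_i| ≤ L_i ‖x − y‖_∞`, then for
  every integer `N ≥ 1` the unit cubes `z + [0,1)ⁿ`, `z ∈ ℤⁿ`, meeting `φ([0,1]^m)` number at most
  `N^m ∏_i (2 L_i / N + 2)` (subdivide the cube into `N^m` subcubes; the image of each lies in a
  box of sides `2L_i/N`). With `m = n − 1` and `N ≈ L_min` this is `≍ ∏_{i ≠ min} L_i`, the
  product of the `n − 1` largest constants — Davenport's `V̄` for a linear image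
  `diag(L_1, …, L_n) · (fixed region)`.
* `abs_ncard_sub_volume_le_of_forall_patch` : for `S ⊆ ℝⁿ` bounded whose frontier is covered by
  finitely many such patches, `|#{z ∈ ℤⁿ : z ∈ S} − vol(S)| ≤ Σ_patches N_p^m ∏_i (2L_{p,i}/N_p + 2)`.
* `ncard_inter_coord_eq_zero_le` : the number of integer points of a box `∏ [lo_i, up_i]` on a
  coordinate hyperplane `{z_{i₀} = 0}` is at most `∏_{i ≠ i₀} (up_i − lo_i + 1)` (the points with
  a vanishing coordinate, e.g. Bhargava–Shankar's forms with `a = 0`, are counted separately).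

## References

* H. Davenport, *On a principle of Lipschitz*, J. London Math. Soc. 26 (1951) 179–183; corrigendum
  ibid. 39 (1964) 580. [cite: Davenport1951, Theorem (principle of Lipschitz)]
* M. Bhargava, A. Shankar, Ann. of Math. (2) 181 (2015) 191–242, Props. 2.5–2.6
  (arXiv:1006.1002v2 numbering). [cite: BhargavaShankarAnnals2015, Props. 2.5–2.6 (arXiv:1006.1002v2 numbering)]
* D. A. Marcus, *Number Fields*, 2nd ed., Springer 2018, Ch. 6, proof of Lemma 2 (cell counting;
  vendored in `LatticePointCounting.lean`). [cite: Marcus2018, Ch. 6, Lemma 2]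
-/

noncomputable section

open MeasureTheory Module Submodule Bornology Set Metric ZSpan
open scoped Pointwise NNReal ENNReal

namespace Literature.Algebra.EuclideanLattices

variable {n : ℕ}

/-! ## Integer points and unit cubes of `ℝⁿ` -/

/-- The integer vector `z ∈ ℤⁿ` as a point of `ℝⁿ`. [folklore] -/
def intPt (z : Fin n → ℤ) : Fin n → ℝ := fun i => (z i : ℝ)

/-- Coordinates of `intPt` (definitional). [folklore] -/
@[simp] theorem intPt_apply (z : Fin n → ℤ) (i : Fin n) : intPt z i = (z i : ℝ) := rfl

/-- `intPt` is injective. [folklore] -/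
theorem intPt_injective : Function.Injective (intPt (n := n)) := by
  intro z w h
  funext i
  have := congrFun h i
  simpa [intPt] using this

/-- The half-open unit cube `z + [0,1)ⁿ` with lower corner `z ∈ ℤⁿ`. [folklore] -/
def unitCube (z : Fin n → ℤ) : Set (Fin n → ℝ) :=
  {x | ∀ i, (z i : ℝ) ≤ x i ∧ x i < z i + 1}

/-- `x ∈ z + [0,1)ⁿ ↔ ⌊x_i⌋ = z_i` for all `i`. [folklore] -/
theorem mem_unitCube_iff {z : Fin n → ℤ} {x : Fin n → ℝ} :
    x ∈ unitCube z ↔ ∀ i, ⌊x i⌋ = z i := by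
  simp only [unitCube, Set.mem_setOf_eq, Int.floor_eq_iff]

/-- The `ℤ`-span of the standard basis of `ℝⁿ` is `ℤⁿ`. [folklore] -/
theorem mem_span_basisFun_iff {x : Fin n → ℝ} :
    x ∈ span ℤ (Set.range (Pi.basisFun ℝ (Fin n))) ↔ ∃ z : Fin n → ℤ, x = intPt z := by
  rw [Basis.mem_span_iff_repr_mem]
  constructor
  · intro h
    choose z hz using h
    refine ⟨z, ?_⟩
    funext i
    have := hz i
    simp only [Pi.basisFun_repr, algebraMap_int_eq, eq_intCast] at this
    simp [intPt, this]
  · rintro ⟨z, rfl⟩ i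
    exact ⟨z i, by simp [intPt]⟩

/-- `intPt z` lies in the `ℤ`-span of the standard basis. [folklore] -/
theorem intPt_mem_span (z : Fin n → ℤ) :
    intPt z ∈ span ℤ (Set.range (Pi.basisFun ℝ (Fin n))) :=
  mem_span_basisFun_iff.2 ⟨z, rfl⟩

/-- The coordinates of the `b`-floor for the standard basis `b` are the floors of the coordinates.
[folklore] -/
theorem coe_floor_basisFun_apply (x : Fin n → ℝ) (i : Fin n) :
    ((floor (Pi.basisFun ℝ (Fin n)) x : Fin n → ℝ)) i = ⌊x i⌋ := by
  have h := repr_floor_apply (Pi.basisFun ℝ (Fin n)) x i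
  rwa [Pi.basisFun_repr, Pi.basisFun_repr] at h

/-- The cell of `intPt z` for the standard basis is the unit cube `z + [0,1)ⁿ`. [folklore] -/
theorem cell_basisFun_intPt (z : Fin n → ℤ) :
    cell (Pi.basisFun ℝ (Fin n)) (intPt z) = unitCube z := by
  ext x
  rw [mem_cell, mem_unitCube_iff]
  constructor
  · intro h i
    have := congrFun h i
    rw [coe_floor_basisFun_apply, intPt_apply] at this
    exact_mod_cast this
  · intro h
    funext i
    rw [coe_floor_basisFun_apply, intPt_apply, h i]

/-- The fundamental parallelepiped of the standard basis has volume `1`. [folklore] -/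
theorem volume_real_fundamentalDomain_basisFun :
    volume.real (fundamentalDomain (Pi.basisFun ℝ (Fin n))) = 1 := by
  rw [measureReal_def, fundamentalDomain_pi_basisFun, volume_pi_pi]
  simp

/-- The integer points of `S` correspond to `S ∩ ℤⁿ` inside `ℝⁿ`. [folklore] -/
theorem ncard_setOf_intPt_mem (S : Set (Fin n → ℝ)) :
    {z : Fin n → ℤ | intPt z ∈ S}.ncard =
      Nat.card (S ∩ (span ℤ (Set.range (Pi.basisFun ℝ (Fin n))) : Set (Fin n → ℝ)) : Set _) := by
  rw [← Nat.card_coe_set_eq]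
  apply Nat.card_congr
  refine Equiv.ofBijective (fun z => ⟨intPt z.1, z.2, intPt_mem_span z.1⟩) ⟨?_, ?_⟩
  · intro z w h
    have := congrArg (fun p : (S ∩ (span ℤ (Set.range (Pi.basisFun ℝ (Fin n))) :
      Set (Fin n → ℝ)) : Set _) => (p : Fin n → ℝ)) h
    exact Subtype.ext (intPt_injective this)
  · rintro ⟨x, hxS, hxΛ⟩
    obtain ⟨z, rfl⟩ := mem_span_basisFun_iff.1 hxΛ
    exact ⟨⟨z, hxS⟩, rfl⟩

/-! ## Integers in an interval -/

/-- Casting `Int.toNat`: if `(z : ℝ) ≤ x` and `0 ≤ x` then `(z.toNat : ℝ) ≤ x`. [folklore] -/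
theorem natCast_toNat_le {z : ℤ} {x : ℝ} (h : (z : ℝ) ≤ x) (hx : 0 ≤ x) : ((z.toNat : ℕ) : ℝ) ≤ x := by
  rcases le_or_gt 0 z with hz | hz
  · have e : ((z.toNat : ℕ) : ℝ) = (z : ℝ) := by
      rw [← Int.cast_natCast, Int.toNat_of_nonneg hz]
    rw [e]; exact h
  · rw [Int.toNat_of_nonpos hz.le]; simpa using hx

/-- The integers `z` with `α − r − 1 < z ≤ α + r` (those whose unit interval `[z, z+1)` can meet
`[α − r, α + r]`) lie in `[⌈α − r − 1⌉, ⌊α + r⌋]`, an interval with at most `2r + 2` integers.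
[folklore] -/
theorem card_Icc_ceil_floor_le (α r : ℝ) (hr : 0 ≤ r) :
    ((Finset.Icc ⌈α - r - 1⌉ ⌊α + r⌋).card : ℝ) ≤ 2 * r + 2 := by
  rw [Int.card_Icc]
  have h1 : (⌊α + r⌋ : ℝ) ≤ α + r := Int.floor_le _
  have h2 : α - r - 1 ≤ (⌈α - r - 1⌉ : ℝ) := Int.le_ceil _
  refine natCast_toNat_le ?_ (by positivity)
  push_cast
  linarith

/-! ## The anisotropic Lipschitz principle -/

section Patch

variable {m : ℕ}

/-- The lower corner `k/N` of the subcube of `[0,1]^m` of mesh `1/N` containing `x`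
(`k_j = min(⌊N x_j⌋, N − 1)`). [folklore] -/
def subcubeIndex (N : ℕ) (x : Fin m → ℝ) (j : Fin m) : ℕ :=
  min (⌊(N : ℝ) * x j⌋.toNat) (N - 1)

/-- The corner `k/N` as a point of `ℝ^m`. [folklore] -/
def subcubeCorner (N : ℕ) (k : Fin m → Fin N) : Fin m → ℝ := fun j => (k j : ℝ) / N

/-- For `x ∈ [0,1]^m` the index `k_j = min(⌊N x_j⌋, N−1)` is `< N`. [folklore] -/
theorem subcubeIndex_lt {N : ℕ} (hN : 0 < N) (x : Fin m → ℝ) (j : Fin m) :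
    subcubeIndex N x j < N := by
  unfold subcubeIndex
  omega

/-- The corner lies in `[0,1]^m`. [folklore] -/
theorem subcubeCorner_mem_Icc {N : ℕ} (hN : 0 < N) (k : Fin m → Fin N) :
    subcubeCorner N k ∈ Icc (0 : Fin m → ℝ) 1 := by
  have hN' : (0 : ℝ) < N := by exact_mod_cast hN
  refine ⟨fun j => ?_, fun j => ?_⟩
  · simp only [Pi.zero_apply, subcubeCorner]
    positivity
  · simp only [subcubeCorner, Pi.one_apply]
    rw [div_le_one hN']
    have : ((k j : ℕ) : ℝ) + 1 ≤ N := by exact_mod_cast (k j).2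
    linarith

/-- Every `x ∈ [0,1]^m` is within `1/N` (sup distance) of the corner of its subcube.
[folklore] -/
theorem dist_subcubeCorner_le {N : ℕ} (hN : 0 < N) {x : Fin m → ℝ} (hx : x ∈ Icc (0 : Fin m → ℝ) 1) :
    dist x (subcubeCorner N fun j => ⟨subcubeIndex N x j, subcubeIndex_lt hN x j⟩) ≤ 1 / N := by
  have hN' : (0 : ℝ) < N := by exact_mod_cast hN
  refine (dist_pi_le_iff (by positivity)).2 fun j => ?_
  rw [Real.dist_eq]
  simp only [subcubeCorner, subcubeIndex]
  have hx0 : 0 ≤ x j := hx.1 j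
  have hx1 : x j ≤ 1 := hx.2 j
  set k : ℕ := min (⌊(N : ℝ) * x j⌋.toNat) (N - 1) with hk
  -- `k ≤ N x_j ≤ k + 1`
  have hfl0 : 0 ≤ ⌊(N : ℝ) * x j⌋ := Int.floor_nonneg.2 (by positivity)
  have hfl : (⌊(N : ℝ) * x j⌋ : ℝ) ≤ N * x j := Int.floor_le _
  have hfl' : (N : ℝ) * x j < ⌊(N : ℝ) * x j⌋ + 1 := Int.lt_floor_add_one _
  have htoNat : ((⌊(N : ℝ) * x j⌋.toNat : ℕ) : ℝ) = (⌊(N : ℝ) * x j⌋ : ℝ) := by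
    rw [← Int.cast_natCast, Int.toNat_of_nonneg hfl0]
  have hk1 : (k : ℝ) ≤ N * x j := by
    have : (k : ℝ) ≤ ((⌊(N : ℝ) * x j⌋.toNat : ℕ) : ℝ) := by
      exact_mod_cast min_le_left _ _
    rw [htoNat] at this
    exact this.trans hfl
  have hk2 : (N : ℝ) * x j ≤ k + 1 := by
    rcases le_or_gt (⌊(N : ℝ) * x j⌋.toNat) (N - 1) with h | h
    · rw [hk, min_eq_left h, htoNat]; exact hfl'.le
    · rw [hk, min_eq_right h.le]
      have hN1 : ((N - 1 : ℕ) : ℝ) = N - 1 := by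
        rw [Nat.cast_sub (by omega)]; simp
      rw [hN1]
      nlinarith
  have e : x j - (k : ℝ) / N = (N * x j - k) / N := by field_simp
  rw [e, abs_div, abs_of_pos hN', div_le_div_iff_of_pos_right hN', abs_le]
  constructor <;> linarith

/-- **Anisotropic Lipschitz principle.** Let `φ : [0,1]^m → ℝⁿ` be coordinatewise Lipschitz for
the sup distance, `|φ(x)_i − φ(y)_i| ≤ L_i · d(x, y)` with `L_i ≥ 0`. Then for every integer
`N ≥ 1` there is a finite set `B ⊆ ℤⁿ` with `#B ≤ N^m ∏_i (2L_i/N + 2)` containing every `z`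
whose unit cube `z + [0,1)ⁿ` meets `φ([0,1]^m)`. (Davenport's error term `max V̄` for the linear
image `diag(L) · R` of a fixed region is `≍ ∏_{i ≠ i_min} L_i`, obtained with `N ≈ L_{i_min}`.)
[cite: Davenport1951, Theorem (principle of Lipschitz; anisotropic linear images)] -/
theorem card_unitCubes_meeting_image_le (φ : (Fin m → ℝ) → (Fin n → ℝ)) (L : Fin n → ℝ)
    (hL : ∀ i, 0 ≤ L i)
    (hφ : ∀ x ∈ Icc (0 : Fin m → ℝ) 1, ∀ y ∈ Icc (0 : Fin m → ℝ) 1, ∀ i,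
      |φ x i - φ y i| ≤ L i * dist x y)
    {N : ℕ} (hN : 0 < N) :
    ∃ B : Finset (Fin n → ℤ), (∀ z, (unitCube z ∩ φ '' Icc (0 : Fin m → ℝ) 1).Nonempty → z ∈ B) ∧
      (B.card : ℝ) ≤ (N : ℝ) ^ m * ∏ i, (2 * L i / N + 2) := by
  classical
  have hN' : (0 : ℝ) < N := by exact_mod_cast hN
  -- the box of integer vectors attached to the subcube with corner `k/N`
  let c : (Fin m → Fin N) → Fin n → ℝ := fun k => φ (subcubeCorner N k)
  let box : (Fin m → Fin N) → Finset (Fin n → ℤ) := fun k =>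
    Fintype.piFinset fun i => Finset.Icc ⌈c k i - L i / N - 1⌉ ⌊c k i + L i / N⌋
  refine ⟨Finset.univ.biUnion box, ?_, ?_⟩
  · rintro z ⟨v, hvz, x, hx, rfl⟩
    rw [Finset.mem_biUnion]
    let k : Fin m → Fin N := fun j => ⟨subcubeIndex N x j, subcubeIndex_lt hN x j⟩
    refine ⟨k, Finset.mem_univ _, ?_⟩
    rw [Fintype.mem_piFinset]
    intro i
    have hdist := dist_subcubeCorner_le hN hx
    have hk : subcubeCorner N k ∈ Icc (0 : Fin m → ℝ) 1 := subcubeCorner_mem_Icc hN k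
    have hi := hφ x hx (subcubeCorner N k) hk i
    have hLi : L i * dist x (subcubeCorner N k) ≤ L i / N := by
      calc L i * dist x (subcubeCorner N k) ≤ L i * (1 / N) :=
            mul_le_mul_of_nonneg_left hdist (hL i)
        _ = L i / N := by ring
    have habs : |φ x i - c k i| ≤ L i / N := hi.trans hLi
    obtain ⟨h1, h2⟩ := abs_le.1 habs
    obtain ⟨hz1, hz2⟩ := hvz i
    rw [Finset.mem_Icc]
    constructor
    · rw [Int.ceil_le]
      linarith
    · rw [Int.le_floor]
      linarith
  · calc ((Finset.univ.biUnion box).card : ℝ)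
        ≤ ∑ k : Fin m → Fin N, ((box k).card : ℝ) := by
          exact_mod_cast Finset.card_biUnion_le
      _ ≤ ∑ _k : Fin m → Fin N, ∏ i, (2 * L i / N + 2) := by
          refine Finset.sum_le_sum fun k _ => ?_
          rw [Fintype.card_piFinset, Nat.cast_prod]
          refine Finset.prod_le_prod (fun i _ => by positivity) fun i _ => ?_
          have := card_Icc_ceil_floor_le (c k i) (L i / N) (by have := hL i; positivity)
          calc _ ≤ 2 * (L i / N) + 2 := this
            _ = 2 * L i / N + 2 := by ring
      _ = (N : ℝ) ^ m * ∏ i, (2 * L i / N + 2) := by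
          rw [Finset.sum_const, Finset.card_univ, Fintype.card_fun, Fintype.card_fin,
            Fintype.card_fin, nsmul_eq_mul]
          push_cast
          ring

end Patch

/-! ## Counting with a frontier covered by anisotropic patches -/

/-- **Lattice points versus volume, anisotropic form.** Let `S ⊆ ℝⁿ` be bounded and let its
frontier be covered by finitely many patches `φ_p([0,1]^m)` with `φ_p` coordinatewise Lipschitz
(`|φ_p(x)_i − φ_p(y)_i| ≤ L_{p,i} d(x,y)`). Then for any choice of integers `N_p ≥ 1`,
`|#{z ∈ ℤⁿ : z ∈ S} − vol(S)| ≤ Σ_p N_p^m ∏_i (2 L_{p,i}/N_p + 2)`.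
(Marcus's cell count `abs_card_mul_sub_measure_le` + `card_unitCubes_meeting_image_le`.)
[cite: Davenport1951, Theorem (principle of Lipschitz; anisotropic linear images)] -/
theorem abs_ncard_sub_volume_le_of_forall_patch {S : Set (Fin n → ℝ)} (hS : IsBounded S)
    {P : Type*} [Fintype P] {m : ℕ} (φ : P → (Fin m → ℝ) → (Fin n → ℝ)) (L : P → Fin n → ℝ)
    (hL : ∀ p i, 0 ≤ L p i)
    (hφ : ∀ p, ∀ x ∈ Icc (0 : Fin m → ℝ) 1, ∀ y ∈ Icc (0 : Fin m → ℝ) 1, ∀ i,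
      |φ p x i - φ p y i| ≤ L p i * dist x y)
    (N : P → ℕ) (hN : ∀ p, 0 < N p)
    (hcover : frontier S ⊆ ⋃ p, φ p '' Icc (0 : Fin m → ℝ) 1) :
    |({z : Fin n → ℤ | intPt z ∈ S}.ncard : ℝ) - volume.real S| ≤
      ∑ p, (N p : ℝ) ^ m * ∏ i, (2 * L p i / N p + 2) := by
  classical
  choose B hB hBcard using fun p => card_unitCubes_meeting_image_le (φ p) (L p) (hL p) (hφ p) (hN p)
  -- the finite set of base points (in `ℝⁿ`) of the cells meeting the frontier
  let Bpt : Finset (Fin n → ℝ) := (Finset.univ.biUnion B).image intPt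
  have hBpt : ∀ ℓ ∈ span ℤ (Set.range (Pi.basisFun ℝ (Fin n))),
      (cell (Pi.basisFun ℝ (Fin n)) ℓ ∩ frontier S).Nonempty → ℓ ∈ Bpt := by
    intro ℓ hℓ hne
    obtain ⟨z, rfl⟩ := mem_span_basisFun_iff.1 hℓ
    rw [cell_basisFun_intPt] at hne
    obtain ⟨v, hvz, hvf⟩ := hne
    have := hcover hvf
    rw [Set.mem_iUnion] at this
    obtain ⟨p, hp⟩ := this
    have hz : z ∈ B p := hB p z ⟨v, hvz, hp⟩
    refine Finset.mem_image.2 ⟨z, Finset.mem_biUnion.2 ⟨p, Finset.mem_univ _, hz⟩, rfl⟩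
  have hmain := abs_card_mul_sub_measure_le (Pi.basisFun ℝ (Fin n)) volume hS hBpt
  rw [volume_real_fundamentalDomain_basisFun, mul_one, mul_one, ← ncard_setOf_intPt_mem] at hmain
  refine hmain.trans ?_
  calc (Bpt.card : ℝ) ≤ ((Finset.univ.biUnion B).card : ℝ) := by
        exact_mod_cast Finset.card_image_le
    _ ≤ ∑ p, ((B p).card : ℝ) := by exact_mod_cast Finset.card_biUnion_le
    _ ≤ ∑ p, (N p : ℝ) ^ m * ∏ i, (2 * L p i / N p + 2) := Finset.sum_le_sum fun p _ => hBcard p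

/-! ## Integer points on a coordinate hyperplane of a box -/

/-- The number of integers in `[⌈lo⌉, ⌊up⌋]` is at most `up − lo + 1` (for `lo ≤ up`). [folklore] -/
theorem card_Icc_ceil_floor_le' {lo up : ℝ} (h : lo ≤ up) :
    ((Finset.Icc ⌈lo⌉ ⌊up⌋).card : ℝ) ≤ up - lo + 1 := by
  rw [Int.card_Icc]
  have hfl : (⌊up⌋ : ℝ) ≤ up := Int.floor_le _
  have hce : lo ≤ (⌈lo⌉ : ℝ) := Int.le_ceil _
  refine natCast_toNat_le ?_ (by linarith)
  push_cast
  linarith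

/-- The integer points of a set contained in the box `∏_i [lo_i, up_i]` that lie on the
coordinate hyperplane `{z_{i₀} = 0}` number at most `∏_{i ≠ i₀} (up_i − lo_i + 1)`.
[folklore] -/
theorem ncard_inter_coord_eq_zero_le {S : Set (Fin n → ℝ)} (lo up : Fin n → ℝ)
    (hloup : ∀ i, lo i ≤ up i) (hS : ∀ x ∈ S, ∀ i, lo i ≤ x i ∧ x i ≤ up i) (i₀ : Fin n) :
    ({z : Fin n → ℤ | intPt z ∈ S ∧ z i₀ = 0}.ncard : ℝ) ≤
      ∏ i ∈ Finset.univ.erase i₀, (up i - lo i + 1) := by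
  classical
  let I : Fin n → Finset ℤ := fun i => if i = i₀ then {0} else Finset.Icc ⌈lo i⌉ ⌊up i⌋
  let box : Finset (Fin n → ℤ) := Fintype.piFinset I
  have hsub : {z : Fin n → ℤ | intPt z ∈ S ∧ z i₀ = 0} ⊆ box := by
    rintro z ⟨hz, hz0⟩
    simp only [Finset.mem_coe, box, Fintype.mem_piFinset]
    intro i
    by_cases hi : i = i₀
    · subst hi; simp [I, hz0]
    · simp only [I, if_neg hi, Finset.mem_Icc]
      obtain ⟨h1, h2⟩ := hS _ hz i
      simp only [intPt_apply] at h1 h2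
      exact ⟨Int.ceil_le.2 h1, Int.le_floor.2 h2⟩
  have h1 : ({z : Fin n → ℤ | intPt z ∈ S ∧ z i₀ = 0}.ncard : ℝ) ≤ box.card := by
    have := Set.ncard_le_ncard hsub box.finite_toSet
    rw [Set.ncard_coe_finset] at this
    exact_mod_cast this
  refine h1.trans ?_
  rw [Fintype.card_piFinset, ← Finset.prod_erase_mul _ _ (Finset.mem_univ i₀)]
  simp only [I, if_pos rfl, Finset.card_singleton, Nat.cast_prod, mul_one]
  refine Finset.prod_le_prod (fun i _ => by positivity) fun i hi => ?_
  rw [Finset.mem_erase] at hi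
  rw [if_neg hi.1]
  exact card_Icc_ceil_floor_le' (hloup i)

/-- All the integer points of a set inside the box `∏_i [lo_i, up_i]` number at most
`∏_i (up_i − lo_i + 1)`. [folklore] -/
theorem ncard_setOf_intPt_mem_le {S : Set (Fin n → ℝ)} (lo up : Fin n → ℝ)
    (hloup : ∀ i, lo i ≤ up i) (hS : ∀ x ∈ S, ∀ i, lo i ≤ x i ∧ x i ≤ up i) :
    ({z : Fin n → ℤ | intPt z ∈ S}.ncard : ℝ) ≤ ∏ i, (up i - lo i + 1) := by
  classical
  let box : Finset (Fin n → ℤ) := Fintype.piFinset fun i => Finset.Icc ⌈lo i⌉ ⌊up i⌋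
  have hsub : {z : Fin n → ℤ | intPt z ∈ S} ⊆ box := by
    intro z hz
    simp only [Finset.mem_coe, box, Fintype.mem_piFinset, Finset.mem_Icc]
    intro i
    obtain ⟨h1, h2⟩ := hS _ hz i
    simp only [intPt_apply] at h1 h2
    exact ⟨Int.ceil_le.2 h1, Int.le_floor.2 h2⟩
  have h1 : ({z : Fin n → ℤ | intPt z ∈ S}.ncard : ℝ) ≤ box.card := by
    have := Set.ncard_le_ncard hsub box.finite_toSet
    rw [Set.ncard_coe_finset] at this
    exact_mod_cast this
  refine h1.trans ?_
  rw [Fintype.card_piFinset, Nat.cast_prod]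
  exact Finset.prod_le_prod (fun i _ => by positivity) fun i _ => card_Icc_ceil_floor_le' (hloup i)

end Literature.Algebra.EuclideanLattices

end
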